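import Summits.BirchSwinnertonDyer.Rank1Residual.X11b.BDPRouteTwistCertificateCha
import HarnessLib

/-!
# Class X11b, route p2: the twist certificate at EVERY ODD PRIME — `p = 3` included
# (cell `b2b-bsdres`, sub-cell `multr1-p2`, gen 22, file 4; handover by name to the x11b3 team)

HONEST FRAMING (cell `b2b-bsdres`, run/shared/lean/b2b/bsd-rank1-residual/, verbatim in every
file): the goal of the cell is to DELETE the COMBINATION-SHAPED residual classes of the
Birch–Swinnerton-Dyer formula for ALL analytic-rank `≤ 1` elliptic curves over `ℚ` — "full BSD
formula for every rank `≤ 1` curve in class `C`" assembled STRICTLY from published theorems — so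
that the rank-`≤ 1` remainder becomes exactly the CONSTRUCTION-SHAPED classes, which are TYPED
(missing-input `Prop`s), NOT attempted. This is not "finishing BSD". Sub-cell `multr1-p2` is a
RESEARCH ROUTE on class X11b (`ClassX11b W p := r_an = 1 ∧ p ≠ 2 ∧ mult(p) ∧ irr(p)`,
`Partition/Rows.lean`); no claim beyond the stated class and loci; X11b's label does not change;
NOTHING is booked by this file. At `p = 3` the open input `P2OpenInputOnTreeOddAt W 3` (STEP L at
`3 ∥ N`) has NO source in print (the x11b3 team's construction target); every statement below that
uses it is CONDITIONAL on it.

THEOREMS ONLY (no definition, no named fact, no `sorry`).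

WHAT. Files 1–3 of gen 22 (`BDPRouteTwistCertificate`, `…Record`, `…Cha`) state the class-level
twist-certificate theorems for `p ≥ 5`, although the only uses of `5 ≤ p` there are (i) the
Manin-unit Heegner datum, which exists at every ODD multiplicative prime
(`exists_maninDatum_of_odd`, gen 18: Mazur 1978 Cor. 4.1 needs `p` odd with `p² ∤ N`), and (ii) the
Tamagawa transport `p ∤ ∏c(E^{d_K})` used ONLY for the twist's own `BSD(E^{d_K},p)`. This file
restates the `E`-side theorems at EVERY ODD PRIME of the class:
§1 `missingUpperBoundAt_of_classX11b_odd_of_twistUnit` — X11b (`p` odd) ∧ `ρ̄_{E,p}` onto ∧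
`p ∤ ∏c(E)` + ONE twist certificate at a Heegner field with `d_K < -4` (so `p ∤ w_K = 2`) ⟹ the
Euler-system half `ord_p #Ш(E) ≤ ord_p #Ш(E)_an` (Kolyvagin 1990); `…_of_cha` — the same WITHOUT
surjectivity (Cha 2005 Thm. 21: `ℓ` odd, `ℓ = 3` allowed).
§2 `P2.bsdp_of_openInputOddAt_of_twistUnit` — + the odd open input at the pair ⟹ `BSD(E,p)`. At
`p = 3` this covers the X11b@3 pairs with `ρ̄_{E,3}` onto and `3 ∤ ∏c(E)` — SPLIT at `3` included,
with NO `3`-adic regulator, NO mod-`9` image certificate, NO second multiplicative prime (compare gen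
21's `P2.bsdp_of_surj_nonsplit_odd_of_schneider`: non-split only, REG3, `ρ̄_{E,3^n}` onto ∀ `n`).
§3 `bsdp_of_classX11b_odd_of_twistUnit_of_padicValRat_shaAn_le_of_cha` — the per-pair closure
WITHOUT any open input at every odd `p`: twist certificate + `ord_p #Ш(E)_an ≤ 0` ⟹ `BSD(E,p)`
(at `p = 3`: a closure road for X11b@3 pairs with `3 ∤ ∏c(E)` from two exact rationals and
Cremona's `#Ш_an`, no Heegner index, no `3`-adic analysis).
Labels UNCHANGED; nothing booked; X11b stays CONSTRUCTION-SHAPED; census output is EVIDENCE.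
References: [McCallumLMS1991] §1 Theorem (Kolyvagin), p. 296; [Cha2005] Thm. 21 (p. 173);
[Miller2011LMS] Thm. 5.2, Def. 1.1; [JetchevSkinnerWan2017] §7.4.1 (eq:gz for K′); [Mazur1978]
Cor. 4.1; [Darmon2004] Thm. 3.6; [SilvermanATAEC1994] II.6.4, IV.10.2.
-/

noncomputable section

open scoped Classical NumberField

open WeierstrassCurve NumberField IsDedekindDomain Field
open Literature.NumberTheory.EllipticCurves Literature.NumberTheory.EllipticCurves.GreenbergSelmer
  Literature.NumberTheory.EllipticCurves.ModularForms
  Literature.NumberTheory.EllipticCurves.Rank1Residual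
  Literature.NumberTheory.EllipticCurves.Rank1Residual.Typed
  Literature.NumberTheory.EllipticCurves.Cha2005
  Literature.NumberTheory.EllipticCurves.Wuthrich2014
  Literature.NumberTheory.QuadraticFields.Quadratic
  Literature.NumberTheory.Automorphic
  Literature.NumberTheory.GaloisRepresentations Literature.NumberTheory.GaloisCohomology

namespace Summit.BirchSwinnertonDyer.Rank1Residual.X11b

section Pair

variable (W : WeierstrassCurve ℚ) [W.IsElliptic] [W.IsGloballyMinimal] (p : ℕ) [Fact p.Prime]

/-! ### §1. X11b at every odd prime: the Euler-system half from ONE twist certificate -/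

/-- **X11b (`p` odd — `p = 3` included) ∧ `ρ̄_{E,p}` onto ∧ `p ∤ ∏_ℓ c_ℓ(E)`, at a GIVEN Heegner
field `K` with `d_K < -4` and a unit twist value: `#Ш(E)_an = q ∈ ℚ` with
`ord_p #Ш(E) + ord_p #Ш(Wd) ≤ ord_p q`.** As `exists_shaAn_padicValNat_shaOrder_add_le_of_classX11b_of_twistUnit`
(gen 22 file 1) with the Manin-unit datum taken from `exists_maninDatum_of_odd` (`p` odd, `p² ∤ N_E`
by multiplicativity). PUBLISHED binders: Gross–Zagier, Kolyvagin ×2 (`hKo`, `hB`), GZK, modularity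
×2, Mazur 1978 Cor. 4.1. Per pair; nothing booked. [cite: McCallumLMS1991, §1 Theorem (Kolyvagin), p. 296]
[cite: JetchevSkinnerWan2017, §7.4.1 (eq:gz for K′), p. 30] [cite: Mazur1978, Cor. 4.1]
[cite: Miller2011LMS, §1 and Def. 1.1] -/
theorem exists_shaAn_padicValNat_shaOrder_add_le_of_classX11b_odd_of_twistUnit
    (hGZ : ∀ (N : ℕ) [NeZero N] (W : WeierstrassCurve ℚ) (K : Type) [Field K] [NumberField K],
      gross_zagier N W K)
    (hKo : ∀ (N : ℕ) [NeZero N] (W : WeierstrassCurve ℚ) (K : Type) [Field K] [NumberField K],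
      kolyvagin N W K)
    (hB : ∀ (N : ℕ) [NeZero N] (W : WeierstrassCurve ℚ) (K : Type) [Field K] [NumberField K],
      Kolyvagin1990_padicValNat_card_sha_le N W K)
    (hGZK : rank_eq_analyticRank_of_analyticRank_le_one) (hmod : hasEntireLFunction_rat)
    (hnf : exists_isNewformOf) (hMaz : mazur_not_dvd_maninConstant_of_odd)
    -- the pair: X11b (any odd `p`), surjective, `p ∤ ∏c`
    (hX : ClassX11b W p) (hsurj : Surj W p) (htam : ¬ p ∣ W.tamagawaProduct)
    -- the certificate
    (K : Type) [Field K] [NumberField K] (hK : IsImaginaryQuadratic K)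
    (hHN : SatisfiesHeegnerHypothesis (W.conductorNorm ℤ) K) (hdK : NumberField.discr K < -4)
    (Wd : WeierstrassCurve ℚ) [Wd.IsElliptic] [Wd.IsGloballyMinimal] (Cd : VariableChange ℚ)
    (hWd : Cd • W.quadraticTwist (NumberField.discr K : ℚ) = Wd)
    (qd : ℚ) (hqd : Wd.entireLFunction 1 / (Wd.realPeriodRat : ℂ) = (qd : ℂ)) (hqd0 : qd ≠ 0)
    (hvd : padicValRat p qd = 0) :
    ∃ q : ℚ, shaAn W = (q : ℂ) ∧
      (padicValNat p W.shaOrder : ℤ) + padicValNat p Wd.shaOrder ≤ padicValRat p q := by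
  obtain ⟨hr, hp2, hmult, hirr⟩ := hX
  haveI : NeZero (W.conductorNorm ℤ) := ⟨(W.conductorNorm_pos_holds).ne'⟩
  have hμ : ¬ p ∣ Units.torsionOrder K := by
    rw [Literature.NumberTheory.DiophantineGeometry.torsionOrder_eq_two_of_discr_lt hK.1 hdK]
    intro h2
    have := Nat.le_of_dvd two_pos h2
    have := (Fact.out : p.Prime).two_le
    omega
  obtain ⟨Dt, H, ι, P, hP, hc⟩ :=
    exists_maninDatum_of_odd hnf hMaz integral_neronScaling_of_isGloballyMinimal_holds W p
      (W.conductorNorm ℤ) K rfl hp2 hmult hirr hK hHN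
  have hu : padicValRat p (Cd.u : ℚ) = 0 :=
    padicValRat_u_eq_zero_of_twist_minimal W p K hK hHN hmult Cd hWd
  obtain ⟨q, hq, hvq, hle⟩ :=
    exists_shaAn_padicValNat_shaOrder_add_le_of_heegner_of_twistUnit W p (W.conductorNorm ℤ) K Dt H
      ι P (hGZ _ W K) (hKo _ W K) (hB _ W K) hGZK hmod hK hHN hP hp2 hc hμ hr hsurj Wd Cd hWd hu qd
      hqd hqd0 hvd htam
  refine ⟨q, hq, ?_⟩
  rw [hvq]
  exact_mod_cast hle

/-- **The Euler-system half `Typed.MissingUpperBoundAt W p` on X11b at EVERY ODD PRIME (`p = 3`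
included) ∧ `ρ̄_{E,p}` onto ∧ `p ∤ ∏c(E)`, from ONE twist certificate** (Kolyvagin 1990). Per pair;
nothing booked. [cite: McCallumLMS1991, §1 Theorem (Kolyvagin), p. 296]
[cite: JetchevSkinnerWan2017, §7.4.1 (p. 30)] [cite: Miller2011LMS, Def. 1.1] -/
theorem missingUpperBoundAt_of_classX11b_odd_of_twistUnit
    (hGZ : ∀ (N : ℕ) [NeZero N] (W : WeierstrassCurve ℚ) (K : Type) [Field K] [NumberField K],
      gross_zagier N W K)
    (hKo : ∀ (N : ℕ) [NeZero N] (W : WeierstrassCurve ℚ) (K : Type) [Field K] [NumberField K],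
      kolyvagin N W K)
    (hB : ∀ (N : ℕ) [NeZero N] (W : WeierstrassCurve ℚ) (K : Type) [Field K] [NumberField K],
      Kolyvagin1990_padicValNat_card_sha_le N W K)
    (hGZK : rank_eq_analyticRank_of_analyticRank_le_one) (hmod : hasEntireLFunction_rat)
    (hnf : exists_isNewformOf) (hMaz : mazur_not_dvd_maninConstant_of_odd)
    (hX : ClassX11b W p) (hsurj : Surj W p) (htam : ¬ p ∣ W.tamagawaProduct)
    (K : Type) [Field K] [NumberField K] (hK : IsImaginaryQuadratic K)
    (hHN : SatisfiesHeegnerHypothesis (W.conductorNorm ℤ) K) (hdK : NumberField.discr K < -4)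
    (Wd : WeierstrassCurve ℚ) [Wd.IsElliptic] [Wd.IsGloballyMinimal] (Cd : VariableChange ℚ)
    (hWd : Cd • W.quadraticTwist (NumberField.discr K : ℚ) = Wd)
    (qd : ℚ) (hqd : Wd.entireLFunction 1 / (Wd.realPeriodRat : ℂ) = (qd : ℂ)) (hqd0 : qd ≠ 0)
    (hvd : padicValRat p qd = 0) :
    Typed.MissingUpperBoundAt W p := by
  obtain ⟨q, hq, hle⟩ := exists_shaAn_padicValNat_shaOrder_add_le_of_classX11b_odd_of_twistUnit W p
    hGZ hKo hB hGZK hmod hnf hMaz hX hsurj htam K hK hHN hdK Wd Cd hWd qd hqd hqd0 hvd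
  refine ⟨q, hq, ?_⟩
  have h0 : (0 : ℤ) ≤ padicValNat p Wd.shaOrder := by exact_mod_cast Nat.zero_le _
  linarith

/-- **The Euler-system half on X11b at EVERY ODD PRIME ∧ `p ∤ ∏c(E)` from ONE twist certificate,
with NO surjectivity** (Cha 2005 Thm. 21 — `ℓ` odd, `ℓ = 3` allowed, `ρ̄` irreducible; non-CM,
`p ∤ d_K`, `p² ∤ N_E` automatic). Per pair; nothing booked. [cite: Cha2005, Thm. 21 (p. 173)]
[cite: Miller2011LMS, Thm. 5.2, Def. 1.1] [cite: JetchevSkinnerWan2017, §7.4.1 (p. 30)] -/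
theorem missingUpperBoundAt_of_classX11b_odd_of_twistUnit_of_cha
    (hGZ : ∀ (N : ℕ) [NeZero N] (W : WeierstrassCurve ℚ) (K : Type) [Field K] [NumberField K],
      gross_zagier N W K)
    (hKo : ∀ (N : ℕ) [NeZero N] (W : WeierstrassCurve ℚ) (K : Type) [Field K] [NumberField K],
      kolyvagin N W K)
    (hCha : thm52_padicValNat_shaOrder_le)
    (hGZK : rank_eq_analyticRank_of_analyticRank_le_one) (hmod : hasEntireLFunction_rat)
    (hnf : exists_isNewformOf) (hMaz : mazur_not_dvd_maninConstant_of_odd)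
    (hX : ClassX11b W p) (htam : ¬ p ∣ W.tamagawaProduct)
    (K : Type) [Field K] [NumberField K] (hK : IsImaginaryQuadratic K)
    (hHN : SatisfiesHeegnerHypothesis (W.conductorNorm ℤ) K) (hdK : NumberField.discr K < -4)
    (Wd : WeierstrassCurve ℚ) [Wd.IsElliptic] [Wd.IsGloballyMinimal] (Cd : VariableChange ℚ)
    (hWd : Cd • W.quadraticTwist (NumberField.discr K : ℚ) = Wd)
    (qd : ℚ) (hqd : Wd.entireLFunction 1 / (Wd.realPeriodRat : ℂ) = (qd : ℂ)) (hqd0 : qd ≠ 0)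
    (hvd : padicValRat p qd = 0) :
    ∃ q : ℚ, shaAn W = (q : ℂ) ∧ (padicValNat p W.shaOrder : ℤ) ≤ padicValRat p q := by
  have hp : p.Prime := Fact.out
  obtain ⟨hr, hp2, hmult, hirr⟩ := hX
  haveI : NeZero (W.conductorNorm ℤ) := ⟨(W.conductorNorm_pos_holds).ne'⟩
  have hμ : ¬ p ∣ Units.torsionOrder K := by
    rw [Literature.NumberTheory.DiophantineGeometry.torsionOrder_eq_two_of_discr_lt hK.1 hdK]
    intro h2
    have := Nat.le_of_dvd two_pos h2
    have := hp.two_le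
    omega
  have hcm : ¬ W.HasCM := fun hCM ↦ not_mult_of_hasCM W hCM p hmult
  have hpD : ¬ (p : ℤ) ∣ NumberField.discr K :=
    not_dvd_discr_of_satisfiesHeegnerHypothesis hK hHN hp (dvd_conductorNorm_of_mult hmult)
  have hpN : ¬ p ^ 2 ∣ W.conductorNorm ℤ := not_sq_dvd_conductorNorm_of_mult W p hmult
  obtain ⟨Dt, H, ι, P, hP, hc⟩ :=
    exists_maninDatum_of_odd hnf hMaz integral_neronScaling_of_isGloballyMinimal_holds W p
      (W.conductorNorm ℤ) K rfl hp2 hmult hirr hK hHN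
  have hu : padicValRat p (Cd.u : ℚ) = 0 :=
    padicValRat_u_eq_zero_of_twist_minimal W p K hK hHN hmult Cd hWd
  obtain ⟨q, hq, hvq, hle⟩ :=
    exists_shaAn_padicValNat_shaOrder_le_of_heegner_of_twistUnit_of_cha W p (W.conductorNorm ℤ) K Dt
      H ι P (hGZ _ W K) (hKo _ W K) hCha hGZK hmod hK hHN hP hp2 hc hμ hr hirr hcm hpD hpN Wd Cd hWd
      hu qd hqd hqd0 hvd htam
  refine ⟨q, hq, ?_⟩
  rw [hvq]
  exact_mod_cast hle

/-! ### §2. With the odd open input at the pair: `BSD(E,p)` at every odd prime -/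

/-- **X11b at EVERY ODD PRIME (`p = 3` included) ∧ `ρ̄_{E,p}` onto ∧ `p ∤ ∏_ℓ c_ℓ(E)`: the odd open
input at the pair + ONE twist certificate ⟹ `BSD(E,p)`.** Lower half:
`P2.missingLowerBoundAt_of_openInputOddAt` from `P2OpenInputOnTreeOddAt W p` [for `p ≥ 5`: erratum
(2.4) ⇐ FW21 4.41, UNREFEREED; at `p = 3`: NO source — the x11b3 team's STEP L at `3 ∥ N`]. Upper
half: §1 (Kolyvagin 1990 + the Gross–Zagier identity + the unit twist value). SPLIT at `p` allowed;
NO regulator, NO mod-`p²` image hypothesis, NO second multiplicative prime, NO (ram). CONDITIONAL on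
the open input; per pair; nothing booked. [cite: McCallumLMS1991, §1 Theorem (Kolyvagin), p. 296]
[cite: Castella2018Erratum, (2.4) (p. 1)] [cite: Skinner2016PacificMC, Thm. C (§1, footnote 1)]
[cite: Miller2011LMS, Def. 1.1] -/
theorem P2.bsdp_of_openInputOddAt_of_twistUnit
    (hGZ : ∀ (N : ℕ) [NeZero N] (W : WeierstrassCurve ℚ) (K : Type) [Field K] [NumberField K],
      gross_zagier N W K)
    (hKo : ∀ (N : ℕ) [NeZero N] (W : WeierstrassCurve ℚ) (K : Type) [Field K] [NumberField K],
      kolyvagin N W K)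
    (hB : ∀ (N : ℕ) [NeZero N] (W : WeierstrassCurve ℚ) (K : Type) [Field K] [NumberField K],
      Kolyvagin1990_padicValNat_card_sha_le N W K)
    (hWu : sha_dvd_analyticSha)
    (hGZK : rank_eq_analyticRank_of_analyticRank_le_one) (hmod : hasEntireLFunction_rat)
    (hnf : exists_isNewformOf) (hHL : HoffsteinLuo1997_exists_twist_L_one_ne_zero)
    (hMaz : mazur_not_dvd_maninConstant_of_odd)
    (hPT : ∀ (K : Type) [Field K] [NumberField K], poitouTate_sum_localTatePairing_eq_zero K)
    (hEP : ∀ (K : Type) [Field K] [NumberField K] (v : HeightOneSpectrum (𝓞 K)),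
      localEulerPoincareCharacteristic (v.adicCompletion K))
    -- THE odd open input, at this pair
    (hA : P2OpenInputOnTreeOddAt W p)
    -- the pair and the certificate
    (hX : ClassX11b W p) (hsurj : Surj W p) (htam : ¬ p ∣ W.tamagawaProduct)
    (K : Type) [Field K] [NumberField K] (hK : IsImaginaryQuadratic K)
    (hHN : SatisfiesHeegnerHypothesis (W.conductorNorm ℤ) K) (hdK : NumberField.discr K < -4)
    (Wd : WeierstrassCurve ℚ) [Wd.IsElliptic] [Wd.IsGloballyMinimal] (Cd : VariableChange ℚ)
    (hWd : Cd • W.quadraticTwist (NumberField.discr K : ℚ) = Wd)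
    (qd : ℚ) (hqd : Wd.entireLFunction 1 / (Wd.realPeriodRat : ℂ) = (qd : ℂ)) (hqd0 : qd ≠ 0)
    (hvd : padicValRat p qd = 0) :
    BSDp W p :=
  Typed.bsdp_of_missingPPartAt W p hGZK (by rw [hX.1])
    (Typed.missingPPartAt_of_lower_of_upper W p
      (P2.missingLowerBoundAt_of_openInputOddAt W p hGZ hKo hWu hGZK hmod hnf hHL hMaz hPT hEP hA hX
        hsurj)
      (missingUpperBoundAt_of_classX11b_odd_of_twistUnit W p hGZ hKo hB hGZK hmod hnf hMaz hX hsurj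
        htam K hK hHN hdK Wd Cd hWd qd hqd hqd0 hvd))

/-! ### §3. The per-pair closure WITHOUT any open input, at every odd prime -/

/-- **PER-PAIR CLOSURE at EVERY ODD PRIME (`p = 3` included), NO surjectivity, NO open input, NO
regulator.** On X11b ∧ `p ∤ ∏_ℓ c_ℓ(E)`: a twist certificate `(K, Wd, q_d)` (`d_K < -4`, `q_d ≠ 0`,
`ord_p q_d = 0`) and `ord_p #Ш(E)_an ≤ 0` give `BSD(E,p)` (Cha 2005). Per pair; nothing booked;
X11b's label unchanged. [cite: Cha2005, Thm. 21 (p. 173)] [cite: Miller2011LMS, Thm. 5.2, Def. 1.1, Prop. 7.6]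
[cite: JetchevSkinnerWan2017, §7.4.1 (p. 30)] -/
theorem bsdp_of_classX11b_odd_of_twistUnit_of_padicValRat_shaAn_le_of_cha
    (hGZ : ∀ (N : ℕ) [NeZero N] (W : WeierstrassCurve ℚ) (K : Type) [Field K] [NumberField K],
      gross_zagier N W K)
    (hKo : ∀ (N : ℕ) [NeZero N] (W : WeierstrassCurve ℚ) (K : Type) [Field K] [NumberField K],
      kolyvagin N W K)
    (hCha : thm52_padicValNat_shaOrder_le)
    (hGZK : rank_eq_analyticRank_of_analyticRank_le_one) (hmod : hasEntireLFunction_rat)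
    (hnf : exists_isNewformOf) (hMaz : mazur_not_dvd_maninConstant_of_odd)
    (hX : ClassX11b W p) (htam : ¬ p ∣ W.tamagawaProduct)
    (K : Type) [Field K] [NumberField K] (hK : IsImaginaryQuadratic K)
    (hHN : SatisfiesHeegnerHypothesis (W.conductorNorm ℤ) K) (hdK : NumberField.discr K < -4)
    (Wd : WeierstrassCurve ℚ) [Wd.IsElliptic] [Wd.IsGloballyMinimal] (Cd : VariableChange ℚ)
    (hWd : Cd • W.quadraticTwist (NumberField.discr K : ℚ) = Wd)
    (qd : ℚ) (hqd : Wd.entireLFunction 1 / (Wd.realPeriodRat : ℂ) = (qd : ℂ)) (hqd0 : qd ≠ 0)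
    (hvd : padicValRat p qd = 0)
    {s : ℚ} (hs : shaAn W = (s : ℂ)) (hv : padicValRat p s ≤ 0) : BSDp W p := by
  obtain ⟨q, hq, hle⟩ := missingUpperBoundAt_of_classX11b_odd_of_twistUnit_of_cha W p hGZ hKo hCha
    hGZK hmod hnf hMaz hX htam K hK hHN hdK Wd Cd hWd qd hqd hqd0 hvd
  have hqs : q = s := by exact_mod_cast hq.symm.trans hs
  subst hqs
  exact bsdp_of_upper_of_padicValRat_shaAn_le W p hGZK (by rw [hX.1]) hq hle hv

/-- **PER-PAIR CLOSURE at EVERY ODD PRIME with surjectivity (Kolyvagin 1990): `BSD(E,p)` and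
`ord_p #Ш(E^{d_K}) = 0`.** (The twist's own `BSD(E^{d_K},p)` additionally needs `p ∤ ∏c(E^{d_K})`,
automatic only for `p ≥ 5`: `bsdp_and_bsdp_twist_of_classX11b_of_twistUnit_of_padicValRat_shaAn_le`.)
Per pair; nothing booked. [cite: McCallumLMS1991, §1 Theorem (Kolyvagin), p. 296]
[cite: Miller2011LMS, Def. 1.1, Prop. 7.6] [cite: JetchevSkinnerWan2017, §7.4.1 (p. 30)] -/
theorem bsdp_of_classX11b_odd_of_twistUnit_of_padicValRat_shaAn_le
    (hGZ : ∀ (N : ℕ) [NeZero N] (W : WeierstrassCurve ℚ) (K : Type) [Field K] [NumberField K],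
      gross_zagier N W K)
    (hKo : ∀ (N : ℕ) [NeZero N] (W : WeierstrassCurve ℚ) (K : Type) [Field K] [NumberField K],
      kolyvagin N W K)
    (hB : ∀ (N : ℕ) [NeZero N] (W : WeierstrassCurve ℚ) (K : Type) [Field K] [NumberField K],
      Kolyvagin1990_padicValNat_card_sha_le N W K)
    (hGZK : rank_eq_analyticRank_of_analyticRank_le_one) (hmod : hasEntireLFunction_rat)
    (hnf : exists_isNewformOf) (hMaz : mazur_not_dvd_maninConstant_of_odd)
    (hX : ClassX11b W p) (hsurj : Surj W p) (htam : ¬ p ∣ W.tamagawaProduct)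
    (K : Type) [Field K] [NumberField K] (hK : IsImaginaryQuadratic K)
    (hHN : SatisfiesHeegnerHypothesis (W.conductorNorm ℤ) K) (hdK : NumberField.discr K < -4)
    (Wd : WeierstrassCurve ℚ) [Wd.IsElliptic] [Wd.IsGloballyMinimal] (Cd : VariableChange ℚ)
    (hWd : Cd • W.quadraticTwist (NumberField.discr K : ℚ) = Wd)
    (qd : ℚ) (hqd : Wd.entireLFunction 1 / (Wd.realPeriodRat : ℂ) = (qd : ℂ)) (hqd0 : qd ≠ 0)
    (hvd : padicValRat p qd = 0)
    {s : ℚ} (hs : shaAn W = (s : ℂ)) (hv : padicValRat p s ≤ 0) :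
    BSDp W p ∧ padicValNat p Wd.shaOrder = 0 := by
  obtain ⟨q, hq, hle⟩ := exists_shaAn_padicValNat_shaOrder_add_le_of_classX11b_odd_of_twistUnit W p
    hGZ hKo hB hGZK hmod hnf hMaz hX hsurj htam K hK hHN hdK Wd Cd hWd qd hqd hqd0 hvd
  have hqs : q = s := by exact_mod_cast hq.symm.trans hs
  subst hqs
  have h0 : (0 : ℤ) ≤ padicValNat p Wd.shaOrder := by exact_mod_cast Nat.zero_le _
  have h0' : (0 : ℤ) ≤ padicValNat p W.shaOrder := by exact_mod_cast Nat.zero_le _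
  refine ⟨bsdp_of_upper_of_padicValRat_shaAn_le W p hGZK (by rw [hX.1]) hq (by linarith) hv, ?_⟩
  have : (padicValNat p Wd.shaOrder : ℤ) ≤ 0 := by linarith
  omega

end Pair

end Summit.BirchSwinnertonDyer.Rank1Residual.X11b

end
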